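import Summits.AtomisticToContinuum.HydrodynamicLimit.Theses.ImplosionDichotomy
import Literature.Analysis.FunctionSpaces.TorusSpaceTime

/-!
# Under `HsEosLowDensity` the pressure field of a dilute classical solution is smooth

Helper for the crux `ImplosionDichotomy.PolynomialCompression` (stmt-AtomisticToContinuum-12587) and for every line
on it, from the standing disprover's `Cruxes/PolynomialCompression/Disproof.lean` §8 (input I3) / §10 (cycle 3): the
route's support item `HsEosLowDensity` (stmt-0768: the hard-sphere excess free energy is real-analytic near packing
`0`) is exactly what turns the typed compressibility factor `Z = hsCompressibility = 1 + η·deriv hsExcessFreeEnergy η`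
from `deriv`-junk into a smooth function on packing `(0, η₀)` (`exists_smooth_compressibility`), hence makes the
pressure field `(t, y) ↦ hsPressure σ (ρ t y) (θ t y) = ρθ Z(ρσ³)` of every classical solution with packing `< η₀`
jointly smooth on `[0,T) × 𝕋³` (`isSmoothSpaceTimeOn_pressure`). This discharges the smooth-pressure hypothesis of
`Negative/Energy.lean` / `Negative/Budget.lean` (energy conservation and the σ-uniform energy budget of witnesses),
and it is the regularity every line needs before `Torus.gradient p` in the momentum equation means the classical
gradient (local well-posedness stubs). Without stmt-0768 nothing of the kind is available in the tree: that item is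
load-bearing for BOTH the provers and the disprover. refuter-cdisprove-stmt-AtomisticToContinuum-12587-g3-0.
-/

noncomputable section

namespace Summit.AtomisticToContinuum.HydrodynamicLimit.Theorems

namespace PolynomialCompressionSmoothPressure

open Set Filter Topology
open scoped ContDiff
open Literature.MathematicalPhysics.KineticTheory
open Literature.Analysis.FunctionSpaces
open Summit.AtomisticToContinuum.HydrodynamicLimit.Theses.ImplosionDichotomy (HsEosLowDensity)

/-- **`HsEosLowDensity` makes `Z` smooth at low packing**: there are `η₀ > 0` and `Zf` smooth on `(−η₀, η₀)` with
`Zf 0 = 1` and `hsCompressibility = Zf` on `(0, η₀)` (`Zf η = 1 + η F′(η)`, `F` the analytic free energy).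
[folklore] -/
theorem exists_smooth_compressibility (hEos : HsEosLowDensity) :
    ∃ η₀ : ℝ, 0 < η₀ ∧ ∃ Zf : ℝ → ℝ, ContDiffOn ℝ ∞ Zf (Ioo (-η₀) η₀) ∧
      EqOn hsCompressibility Zf (Ioo 0 η₀) ∧ Zf 0 = 1 := by
  obtain ⟨η₀, hη₀, F, hF, hEq, -, -, -⟩ := hEos
  refine ⟨η₀, hη₀, fun η => 1 + η * deriv F η, ?_, fun η hη => ?_, by simp⟩
  · exact contDiffOn_const.add (contDiffOn_id.mul hF.deriv.contDiffOn_of_completeSpace)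
  · have hnhds : hsExcessFreeEnergy =ᶠ[𝓝 η] F :=
      hEq.eventuallyEq_of_mem (mem_of_superset (Ioo_mem_nhds hη.1 hη.2) Ioo_subset_Ico_self)
    show 1 + η * deriv hsExcessFreeEnergy η = 1 + η * deriv F η
    rw [hnhds.deriv_eq]

/-- **Smooth pressure field along dilute classical solutions** (under `HsEosLowDensity`): there is `η₀ > 0` such that
for every `σ > 0` and every classical hard-sphere-Euler solution whose packing stays `< η₀` on `[0,T) × 𝕋³`, the
pressure field `(t, y) ↦ hsPressure σ (ρ t y) (θ t y)` is jointly smooth on `[0,T)`. [folklore] -/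
theorem isSmoothSpaceTimeOn_pressure (hEos : HsEosLowDensity) :
    ∃ η₀ : ℝ, 0 < η₀ ∧ ∀ (σ T : ℝ) (ρ θ : ℝ → T3 → ℝ) (u : ℝ → T3 → V3), 0 < σ →
      IsHardSphereEulerSolution σ T ρ u θ → (∀ t ∈ Ico 0 T, ∀ x, ρ t x * σ ^ 3 < η₀) →
        Torus.IsSmoothSpaceTimeOn (Ico 0 T) (fun t y => hsPressure σ (ρ t y) (θ t y)) := by
  obtain ⟨η₀, hη₀, Zf, hZ, hEqZ, -⟩ := exists_smooth_compressibility hEos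
  refine ⟨η₀, hη₀, fun σ T ρ θ u hσ hE hpack => ?_⟩
  have hP : Torus.IsSmoothSpaceTimeOn (Ico 0 T) (fun t y => ρ t y * σ ^ 3) :=
    hE.smooth_density.mul (contDiffOn_const (c := σ ^ 3))
  have hmem : ∀ z ∈ Ico 0 T ×ˢ (univ : Set (EuclideanSpace ℝ (Fin 3))),
      Torus.stLift (fun t y => ρ t y * σ ^ 3) z ∈ Ioo 0 η₀ := by
    rintro ⟨t, v⟩ hz
    have ht : t ∈ Ico 0 T := hz.1
    exact ⟨mul_pos (hE.density_pos t ht _) (pow_pos hσ 3), hpack t ht _⟩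
  have hmaps : MapsTo (Torus.stLift (fun t y => ρ t y * σ ^ 3)) (Ico 0 T ×ˢ univ) (Ioo (-η₀) η₀) :=
    fun z hz => ⟨(neg_lt_zero.2 hη₀).trans (hmem z hz).1, (hmem z hz).2⟩
  have hZpack : Torus.IsSmoothSpaceTimeOn (Ico 0 T) (fun t y => hsCompressibility (ρ t y * σ ^ 3)) :=
    (hZ.comp hP hmaps).congr fun z hz => hEqZ (hmem z hz)
  show Torus.IsSmoothSpaceTimeOn (Ico 0 T) (fun t y => ρ t y * θ t y * hsCompressibility (ρ t y * σ ^ 3))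
  exact (hE.smooth_density.mul hE.smooth_temperature).mul hZpack

end PolynomialCompressionSmoothPressure

end Summit.AtomisticToContinuum.HydrodynamicLimit.Theorems

end
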